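import Literature.Analysis.FluidPDE.LocalTypeI
import Literature.Analysis.FluidPDE.AncientLimitVanishing
import HarnessLib

/-!
# STRONG EXTINCTION at a REGULAR top point: the local energy of an extinct apex vanishes near every
# backward-regular point of the top slice
# (item `TerminalTrace.TypeITraceScarL3`, stmt-NavierStokesRegularity-18385; ROUND-26 §1e L26-1, step (e) of
# ns-typeII-p3 g9's STRONG-EXTINCTION sketch)

Seat ns-typeII-p3 g10 (cell ns-regularity-ideate), `--supports stmt-NavierStokesRegularity-18385` (helper).
For a pair `(U, P)` suitable in every parabolic ball `Q(a)` at the space–time origin with the plain pressure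
bound `D(z₀, r) ≤ D₀` at apices `z₀.1 ≤ 0` and WEAKLY NULL top trace (`∫⟪U(s), φ⟫ → 0` essentially as
`s → 0⁻`, for every smooth compactly supported `φ`), and a point `y` at which `(0, y)` is NOT backward
singular, there is a radius `r > 0` such that `∫_{B(y,r)} |U(s)|² → 0` essentially as `s → 0⁻`
(`localEnergy_le_near_top_of_not_isBackwardSingularPoint`).

Mechanism (no Arzelà–Ascoli): the local boundedness near `(0, y)` and the tree's regularity tool
`exists_representative_of_ae_bound_of_local_pressure` (Escauriaza–Seregin–Šverák / Wang–Zhang bounded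
regularity with local pressure, proved in the tree, admitting the top time `b = 0`) give a representative
`V` of `U` on `]a, 0[ × B(y, r₁/2)` whose slices are `K`-Lipschitz UNIFORMLY up to the top.  A weakly null
equi-Lipschitz family is uniformly small: on a finite `h`-net `{z_k}` of `B̄(y, r)` test `U` against the
normalised bumps `ψ_k e_i` (`ContDiffBump.normed`) — `|V(s, z_k)_i − ∫ψ_k V(s,·)_i| ≤ K h`
(`abs_apply_sub_integral_bump_le`) while weak nullity makes the finitely many pairings `≤ τ` for a.e. late
`s`; Lipschitz once more from the net to the ball.  The rate and the Morrey bound are not used here.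

WHAT THIS IS NOT: not Stub C / QA / LOUD, not NS regularity — the regular half of STRONG EXTINCTION
(the singular half is `ℋ¹(Σ₀) = 0` + the Morrey bound, assembled in the companion file).
[folklore; EscauriazaSereginSverak2003 §3; Seregin2014 §6.6]
-/

noncomputable section

set_option linter.dupNamespace false

namespace Summit.NavierStokesRegularity.NavierStokesRegularity.Theorems.TypeITraceScarL3

open MeasureTheory Set Function Filter Topology Metric
open Literature.Analysis.FluidPDE
open scoped NNReal ENNReal InnerProductSpace RealInnerProductSpace

/-! ### Two pieces of Euclidean bookkeeping -/

/-- Pairing with a scalar multiple of a coordinate vector picks the coordinate. [folklore] -/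
theorem inner_smul_single_one (v : EuclideanSpace ℝ (Fin 3)) (i : Fin 3) (c : ℝ) :
    ⟪v, c • EuclideanSpace.single i (1 : ℝ)⟫ = c * v i := by
  rw [real_inner_smul_right, EuclideanSpace.inner_single_right]
  simp

/-- If every coordinate of `v ∈ ℝ³` has absolute value `≤ c`, then `‖v‖ ≤ 2c` (`√3 ≤ 2`). [folklore] -/
theorem norm_le_two_mul_of_forall_abs_apply_le {v : EuclideanSpace ℝ (Fin 3)} {c : ℝ} (hc : 0 ≤ c)
    (h : ∀ i : Fin 3, |v i| ≤ c) : ‖v‖ ≤ 2 * c := by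
  have hsq : ‖v‖ ^ 2 ≤ (2 * c) ^ 2 := by
    rw [PiLp.norm_sq_eq_of_L2]
    calc ∑ i : Fin 3, ‖v i‖ ^ 2 ≤ ∑ _i : Fin 3, c ^ 2 := by
          refine Finset.sum_le_sum fun i _ => ?_
          have h1 : ‖v i‖ ≤ c := by rw [Real.norm_eq_abs]; exact h i
          exact pow_le_pow_left₀ (norm_nonneg _) h1 2
      _ = 3 * c ^ 2 := by simp
      _ ≤ (2 * c) ^ 2 := by nlinarith [sq_nonneg c]
  exact (pow_le_pow_iff_left₀ (norm_nonneg v) (by positivity) two_ne_zero).1 hsq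

/-! ### The bump estimate: a Lipschitz field is close to its bump average -/

/-- **Bump average of a locally Lipschitz field.**  Let `b` be a smooth bump centred at `k` with outer
radius `h`, `ψ = b.normed` (`∫ψ = 1`, `ψ ≥ 0`, `supp ψ = B(k, h)`), and let `f : ℝ³ → ℝ³` be continuous on
`B̄(k, h)` with `‖f k − f z‖ ≤ ℓ` for `z ∈ B(k, h)`.  Then the `i`-th coordinate of `f k` differs from the
pairing `∫⟪f, ψ e_i⟫` by at most `ℓ`. [folklore] -/
theorem abs_apply_sub_integral_bump_le {k : EuclideanSpace ℝ (Fin 3)} (b : ContDiffBump k)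
    {f : EuclideanSpace ℝ (Fin 3) → EuclideanSpace ℝ (Fin 3)} {ℓ : ℝ}
    (hcont : ContinuousOn f (closedBall k b.rOut))
    (hlip : ∀ z ∈ ball k b.rOut, ‖f k - f z‖ ≤ ℓ) (i : Fin 3) :
    |f k i - ∫ z, ⟪f z, b.normed volume z • EuclideanSpace.single i (1 : ℝ)⟫| ≤ ℓ := by
  set ψ : EuclideanSpace ℝ (Fin 3) → ℝ := b.normed volume with hψ
  have hψint : Integrable ψ volume := b.integrable_normed
  have hψ1 : ∫ z, ψ z = 1 := b.integral_normed
  have hψ0 : ∀ z, 0 ≤ ψ z := b.nonneg_normed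
  have hψsupp : ∀ z, z ∉ ball k b.rOut → ψ z = 0 := fun z hz => by
    have : z ∉ Function.support ψ := by rw [hψ, b.support_normed_eq]; exact hz
    simpa [Function.mem_support] using this
  -- `ℓ ≥ 0` (the ball is non-empty)
  have hℓ : 0 ≤ ℓ := le_trans (norm_nonneg _) (hlip k (mem_ball_self b.rOut_pos))
  -- the pairing is the bump average of the coordinate
  have hpair : (∫ z, ⟪f z, ψ z • EuclideanSpace.single i (1 : ℝ)⟫) = ∫ z, ψ z * f z i := by
    refine integral_congr_ae (ae_of_all _ fun z => ?_)
    simp only [inner_smul_single_one]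
  -- integrability of `ψ · fᵢ`: continuous on the compact closed ball, zero outside
  have hg_int : Integrable (fun z => ψ z * f z i) volume := by
    have hsupp : Function.support (fun z => ψ z * f z i) ⊆ closedBall k b.rOut := by
      intro z hz
      rw [Function.mem_support] at hz
      by_contra hzc
      exact hz (by rw [hψsupp z (fun h => hzc (ball_subset_closedBall h)), zero_mul])
    rw [← integrableOn_iff_integrable_of_support_subset hsupp]
    refine ContinuousOn.integrableOn_compact (isCompact_closedBall _ _) ?_
    exact (b.continuous_normed.continuousOn).mul
      ((EuclideanSpace.proj i).continuous.comp_continuousOn hcont)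
  -- the coordinate of `f k` is its own bump average
  have hconst : f k i = ∫ z, ψ z * f k i := by
    rw [integral_mul_const, hψ1, one_mul]
  rw [hpair, hconst, ← integral_sub (hψint.mul_const _) hg_int]
  -- pointwise bound `ψ z |f k i − f z i| ≤ ψ z ℓ`
  have hbound : ∀ z, ‖ψ z * f k i - ψ z * f z i‖ ≤ ψ z * ℓ := by
    intro z
    rw [← mul_sub, norm_mul, Real.norm_of_nonneg (hψ0 z)]
    by_cases hz : z ∈ ball k b.rOut
    · refine mul_le_mul_of_nonneg_left ?_ (hψ0 z)
      have h1 : f k i - f z i = (f k - f z) i := by simp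
      rw [h1, Real.norm_eq_abs, ← Real.norm_eq_abs]
      exact (PiLp.norm_apply_le (f k - f z) i).trans (hlip z hz)
    · rw [hψsupp z hz, zero_mul, zero_mul]
  calc |∫ z, (ψ z * f k i - ψ z * f z i)| = ‖∫ z, (ψ z * f k i - ψ z * f z i)‖ := (Real.norm_eq_abs _).symm
    _ ≤ ∫ z, ψ z * ℓ := norm_integral_le_of_norm_le (hψint.mul_const _) (ae_of_all _ hbound)
    _ = ℓ := by rw [integral_mul_const, hψ1, one_mul]

/-! ### Strong extinction near a regular top point -/

/-- **STRONG EXTINCTION NEAR A REGULAR TOP POINT.**  Let `(U, P)` be suitable in every parabolic ball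
`Q(a)` at the origin, with the plain pressure bound `D(z₀, r) ≤ D₀` at apices `z₀.1 ≤ 0` and weakly null
top trace, and let `(0, y)` be NOT backward singular.  Then for some `r > 0` and every `θ > 0` there is
`s₀ < 0` with `∫_{B(y,r)} ‖U(s)‖² ≤ θ` for a.e. `s ∈ ]s₀, 0[`.  Proof: bounded backward cylinder at `(0,y)`
⇒ representative `V` with `K`-Lipschitz slices up to the top (`exists_representative_of_ae_bound_of_local_pressure`);
finite `h`-net of `B̄(y, r)`, `r = r₁/8`; weak nullity on the `3 · #net` bumps `ψ_k e_i`; the bump estimate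
`abs_apply_sub_integral_bump_le`; Lipschitz from the net to the ball; integrate the pointwise bound.
[folklore; EscauriazaSereginSverak2003 §3; Seregin2014 §6.6 (Thm 6.21, local regularity of the limit)] -/
theorem localEnergy_le_near_top_of_not_isBackwardSingularPoint
    {U : ℝ → EuclideanSpace ℝ (Fin 3) → EuclideanSpace ℝ (Fin 3)}
    {P : ℝ → EuclideanSpace ℝ (Fin 3) → ℝ} {D₀ : ℝ≥0}
    (hsw : ∀ a : ℝ, 0 < a →
      IsSuitableWeakSolutionInBall a (0 : ℝ × EuclideanSpace ℝ (Fin 3)) U P)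
    (hD : ∀ z₀ : ℝ × EuclideanSpace ℝ (Fin 3), z₀.1 ≤ 0 →
      ∀ r : ℝ, 0 < r → cknD r z₀ P ≤ D₀)
    (htop : ∀ φ : EuclideanSpace ℝ (Fin 3) → EuclideanSpace ℝ (Fin 3),
      ContDiff ℝ (⊤ : ℕ∞) φ →
      HasCompactSupport φ → ∀ ε : ℝ, 0 < ε →
      ∃ s₀ : ℝ, s₀ < 0 ∧ ∀ᵐ s ∂(volume.restrict (Ioo s₀ 0)), |∫ y, ⟪U s y, φ y⟫| ≤ ε)
    {y : EuclideanSpace ℝ (Fin 3)} (hreg : ¬ IsBackwardSingularPoint U ((0 : ℝ), y)) :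
    ∃ r : ℝ, 0 < r ∧ ∀ θ : ℝ, 0 < θ → ∃ s₀ : ℝ, s₀ < 0 ∧
      ∀ᵐ s ∂(volume.restrict (Ioo s₀ 0)),
        ∫⁻ z in ball y r, ‖U s z‖ₑ ^ 2 ≤ ENNReal.ofReal θ := by
  classical
  -- ### Step 1: a bounded backward cylinder of radius `r₁ ≤ 1` at `(0, y)`
  simp only [IsBackwardSingularPoint, not_forall] at hreg
  obtain ⟨r₀, hr₀, hfin₀⟩ := hreg
  set r₁ : ℝ := min r₀ 1 with hr₁
  have hr₁pos : 0 < r₁ := lt_min hr₀ one_pos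
  have hr₁le1 : r₁ ≤ 1 := min_le_right _ _
  set Q₁ : Set (ℝ × EuclideanSpace ℝ (Fin 3)) :=
    parabolicCylinder r₁ (((0 : ℝ), y) : ℝ × EuclideanSpace ℝ (Fin 3)) with hQ₁
  have hfin : eLpNorm (uncurry U) ∞ (volume.restrict Q₁) ≠ ∞ := by
    have hle : eLpNorm (uncurry U) ∞ (volume.restrict Q₁) ≤ eLpNorm (uncurry U) ∞
        (volume.restrict (parabolicCylinder r₀ (((0 : ℝ), y) : ℝ × EuclideanSpace ℝ (Fin 3)))) :=
      eLpNorm_mono_measure _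
        (Measure.restrict_mono (parabolicCylinder_mono hr₁pos.le (min_le_left _ _) _) le_rfl)
    exact ne_top_of_le_ne_top hfin₀ hle
  set L : ℝ := (eLpNorm (uncurry U) ∞ (volume.restrict Q₁)).toReal with hL
  have hbdQ : ∀ᵐ z ∂(volume.restrict Q₁), ‖U z.1 z.2‖ ≤ L := by
    filter_upwards [enorm_ae_le_eLpNormEssSup (uncurry U) (volume.restrict Q₁)] with z hz
    rw [← eLpNorm_exponent_top] at hz
    calc ‖U z.1 z.2‖ = ‖uncurry U z‖ₑ.toReal := (toReal_enorm _).symm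
      _ ≤ L := ENNReal.toReal_mono hfin hz
  -- ### Step 2: the representative with Lipschitz slices up to the top
  have hP : ∀ z₀ : ℝ × EuclideanSpace ℝ (Fin 3), z₀.1 ≤ 0 →
      ∫⁻ q in parabolicCylinder 1 z₀, ‖P q.1 q.2‖ₑ ^ (3 / 2 : ℝ) ≤ D₀ := by
    intro z₀ hz₀
    have h := hD z₀ hz₀ 1 one_pos
    simpa [cknD] using h
  set a : ℝ := -(3 / 4) * r₁ ^ 2 with ha
  have ha_neg : a < 0 := by
    have : 0 < r₁ ^ 2 := by positivity
    rw [ha]; linarith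
  have hSS' : ∀ x ∈ ball y (r₁ / 2), ball x (2 * (r₁ / 4)) ⊆ ball y r₁ := by
    intro x hx z hz
    rw [mem_ball] at hx hz ⊢
    calc dist z y ≤ dist z x + dist x y := dist_triangle _ _ _
      _ < 2 * (r₁ / 4) + r₁ / 2 := add_lt_add hz hx
      _ = r₁ := by ring
  have hbd : ∀ᵐ z ∂(volume.restrict (Ioo (a - 4 * (r₁ / 4) ^ 2) 0 ×ˢ ball y r₁)),
      ‖U z.1 z.2‖ ≤ L := by
    refine ae_restrict_of_ae_restrict_of_subset ?_ hbdQ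
    rintro ⟨s, z⟩ ⟨hs, hz⟩
    rw [hQ₁, mem_parabolicCylinder]
    refine ⟨⟨?_, hs.2⟩, mem_ball.1 hz⟩
    have h1 := hs.1
    rw [ha] at h1
    simp only [zero_sub]
    nlinarith
  obtain ⟨K, V, hVU, -, hCD, -, hbdK⟩ := exists_representative_of_ae_bound_of_local_pressure
    hsw hP (S := ball y (r₁ / 2)) (S' := ball y r₁) isOpen_ball (ρ := r₁ / 4) (by positivity)
    (by linarith) le_rfl hSS' hbd
  -- derived slice bounds
  have hK₁ : ∀ s ∈ Ioo a 0, ∀ z ∈ ball y (r₁ / 2), ‖fderiv ℝ (V s) z‖ ≤ K := fun s hs z hz => by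
    have h := hbdK 1 (by norm_num) (s, z) ⟨hs, hz⟩
    rwa [norm_iteratedFDeriv_one] at h
  have hdiff : ∀ s ∈ Ioo a 0, ∀ z ∈ ball y (r₁ / 2), DifferentiableAt ℝ (V s) z :=
    fun s hs z hz => (hCD (s, z) ⟨hs, hz⟩).differentiableAt (by simp)
  have hcontV : ∀ s ∈ Ioo a 0, ContinuousOn (V s) (ball y (r₁ / 2)) :=
    fun s hs z hz => (hCD (s, z) ⟨hs, hz⟩).continuousAt.continuousWithinAt
  have hlip : ∀ s ∈ Ioo a 0, ∀ z ∈ ball y (r₁ / 2), ∀ w ∈ ball y (r₁ / 2),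
      ‖V s w - V s z‖ ≤ K * ‖w - z‖ := fun s hs z hz w hw =>
    (convex_ball y (r₁ / 2)).norm_image_sub_le_of_norm_fderiv_le (hdiff s hs) (hK₁ s hs) hz hw
  have hK0 : 0 ≤ K := by
    have h := hK₁ (a / 2) ⟨by linarith, by linarith⟩ y (mem_ball_self (by positivity))
    exact (norm_nonneg _).trans h
  -- slices: for a.e. `s ∈ ]a, 0[`, `V s = U s` a.e. on `B(y, r₁/2)`
  have hslice : ∀ᵐ s ∂(volume.restrict (Ioo a 0)),
      ∀ᵐ z ∂(volume.restrict (ball y (r₁ / 2))), V s z = U s z := by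
    have h1 : ∀ᵐ z ∂((volume.restrict (Ioo a 0)).prod (volume.restrict (ball y (r₁ / 2)))),
        uncurry V z = uncurry U z := by
      rw [Measure.prod_restrict, ← Measure.volume_eq_prod]; exact hVU
    filter_upwards [Measure.ae_ae_of_ae_prod h1] with s hs
    filter_upwards [hs] with z hz
    exact hz
  -- ### Step 3: the output radius `r = r₁/8`; fix `θ`
  refine ⟨r₁ / 8, by positivity, fun θ hθ => ?_⟩
  set r : ℝ := r₁ / 8 with hr
  have hrpos : 0 < r := by positivity
  have hvol : volume (ball y r) ≠ ∞ := measure_ball_lt_top.ne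
  set v : ℝ := (volume (ball y r)).toReal + 1 with hv
  have hvpos : 0 < v := by positivity
  set θ₀ : ℝ := Real.sqrt (θ / v) with hθ₀
  have hθ₀pos : 0 < θ₀ := Real.sqrt_pos.2 (div_pos hθ hvpos)
  have hθ₀sq : θ₀ ^ 2 = θ / v := Real.sq_sqrt (div_pos hθ hvpos).le
  -- mesh `h` and tolerance `τ`
  set K' : ℝ := K + 1 with hK'
  have hK'pos : 0 < K' := by positivity
  set h : ℝ := min (r₁ / 8) (θ₀ / (8 * K')) with hh
  have hhpos : 0 < h := lt_min (by positivity) (by positivity)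
  have hh1 : h ≤ r₁ / 8 := min_le_left _ _
  have hh2 : K' * h ≤ θ₀ / 8 := by
    calc K' * h ≤ K' * (θ₀ / (8 * K')) := mul_le_mul_of_nonneg_left (min_le_right _ _) hK'pos.le
      _ = θ₀ / 8 := by field_simp
  set τ : ℝ := θ₀ / 8 with hτ
  have hτpos : 0 < τ := by positivity
  -- the finite `h`-net of the closed ball `B̄(y, r)`
  obtain ⟨t, htsub, htfin, htcov⟩ := finite_cover_balls_of_compact (isCompact_closedBall y r) hhpos
  -- the bumps and the test fields
  let b : ∀ k : EuclideanSpace ℝ (Fin 3), ContDiffBump k :=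
    fun k => ⟨h / 2, h, half_pos hhpos, half_lt_self hhpos⟩
  have hbr : ∀ k, (b k).rOut = h := fun _ => rfl
  set φ : EuclideanSpace ℝ (Fin 3) → Fin 3 → EuclideanSpace ℝ (Fin 3) → EuclideanSpace ℝ (Fin 3) :=
    fun k i z => (b k).normed volume z • EuclideanSpace.single i (1 : ℝ) with hφ
  have hφs : ∀ k i, ContDiff ℝ (⊤ : ℕ∞) (φ k i) := fun k i =>
    ((b k).contDiff_normed).smul contDiff_const
  have hφc : ∀ k i, HasCompactSupport (φ k i) := fun k i => by
    have h1 := ((b k).hasCompactSupport_normed (μ := volume)).smul_right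
      (f' := fun _ : EuclideanSpace ℝ (Fin 3) => EuclideanSpace.single i (1 : ℝ))
    exact h1
  -- weak nullity on each test field
  have hsk : ∀ k i, ∃ s₁ : ℝ, s₁ < 0 ∧
      ∀ᵐ s ∂(volume.restrict (Ioo s₁ 0)), |∫ z, ⟪U s z, φ k i z⟫| ≤ τ :=
    fun k i => htop (φ k i) (hφs k i) (hφc k i) τ hτpos
  choose sk hsk_neg hsk_ae using hsk
  -- the finitely many indices
  set tF : Finset (EuclideanSpace ℝ (Fin 3)) := htfin.toFinset with htF
  have hmem_tF : ∀ k, k ∈ tF ↔ k ∈ t := fun k => by rw [htF, Set.Finite.mem_toFinset]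
  obtain ⟨k₀, hk₀t, -⟩ := mem_iUnion₂.1 (htcov (mem_closedBall_self hrpos.le))
  have htFne : tF.Nonempty := ⟨k₀, (hmem_tF k₀).2 hk₀t⟩
  set I : Finset (EuclideanSpace ℝ (Fin 3) × Fin 3) := tF ×ˢ Finset.univ with hI
  have hIne : I.Nonempty := htFne.product Finset.univ_nonempty
  set s₁ : ℝ := I.sup' hIne (fun p => sk p.1 p.2) with hs₁
  have hs₁neg : s₁ < 0 := (Finset.sup'_lt_iff hIne).2 fun p _ => hsk_neg p.1 p.2
  set s₀ : ℝ := max a s₁ with hs₀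
  have hs₀neg : s₀ < 0 := max_lt ha_neg hs₁neg
  refine ⟨s₀, hs₀neg, ?_⟩
  -- ### Step 4: the a.e. statement on `]s₀, 0[`
  have hsub_a : Ioo s₀ 0 ⊆ Ioo a 0 := Ioo_subset_Ioo_left (le_max_left _ _)
  have hsub_k : ∀ p ∈ I, Ioo s₀ 0 ⊆ Ioo (sk p.1 p.2) 0 := fun p hp =>
    Ioo_subset_Ioo_left ((Finset.le_sup' (fun p => sk p.1 p.2) hp).trans (le_max_right _ _))
  have hall : ∀ᵐ s ∂(volume.restrict (Ioo s₀ 0)), ∀ p ∈ I, |∫ z, ⟪U s z, φ p.1 p.2 z⟫| ≤ τ :=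
    (I.eventually_all).2 fun p hp => ae_restrict_of_ae_restrict_of_subset (hsub_k p hp) (hsk_ae p.1 p.2)
  filter_upwards [ae_restrict_mem measurableSet_Ioo,
    ae_restrict_of_ae_restrict_of_subset hsub_a hslice, hall] with s hs hsl hsm
  have hsa : s ∈ Ioo a 0 := hsub_a hs
  -- the pairings of `U(s)` and of `V(s)` agree
  have hUV : ∀ k ∈ t, ∀ i, (∫ z, ⟪U s z, φ k i z⟫) = ∫ z, ⟪V s z, φ k i z⟫ := by
    intro k hk i
    refine integral_congr_ae ?_
    have h1 : ∀ᵐ z ∂(volume : Measure (EuclideanSpace ℝ (Fin 3))),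
        z ∈ ball y (r₁ / 2) → V s z = U s z := (ae_restrict_iff' measurableSet_ball).1 hsl
    filter_upwards [h1] with z hz
    by_cases hzB : z ∈ ball y (r₁ / 2)
    · rw [hz hzB]
    · -- outside `B(y, r₁/2)` the test field vanishes
      have hzk : z ∉ ball k (b k).rOut := by
        intro hzk
        apply hzB
        rw [hbr] at hzk
        have hky : dist k y ≤ r := htsub hk
        rw [mem_ball] at hzk ⊢
        calc dist z y ≤ dist z k + dist k y := dist_triangle _ _ _
          _ < h + r := add_lt_add_of_lt_of_le hzk hky
          _ ≤ r₁ / 8 + r₁ / 8 := add_le_add hh1 le_rfl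
          _ < r₁ / 2 := by linarith
      have hψ0 : (b k).normed volume z = 0 := by
        have : z ∉ Function.support ((b k).normed volume) := by
          rw [(b k).support_normed_eq]; exact hzk
        simpa [Function.mem_support] using this
      simp only [hφ, hψ0, zero_smul, inner_zero_right]
  -- pointwise bound on `V(s)` over `B(y, r)`
  have hptw : ∀ z ∈ ball y r, ‖V s z‖ ≤ θ₀ := by
    intro z hz
    obtain ⟨k, hkt, hzk⟩ := mem_iUnion₂.1 (htcov (ball_subset_closedBall hz))
    have hky : dist k y ≤ r := htsub hkt
    have hk2 : k ∈ ball y (r₁ / 2) := mem_ball.2 (by linarith)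
    have hz2 : z ∈ ball y (r₁ / 2) := mem_ball.2 (by linarith [mem_ball.1 hz])
    -- Lipschitz bound on the bump ball and continuity on its closure
    have hballk : closedBall k h ⊆ ball y (r₁ / 2) := fun w hw => by
      rw [mem_closedBall] at hw
      rw [mem_ball]
      calc dist w y ≤ dist w k + dist k y := dist_triangle _ _ _
        _ ≤ h + r := add_le_add hw hky
        _ < r₁ / 2 := by linarith
    have hcontk : ContinuousOn (V s) (closedBall k (b k).rOut) := by
      rw [hbr]; exact (hcontV s hsa).mono hballk
    have hlipk : ∀ w ∈ ball k (b k).rOut, ‖V s k - V s w‖ ≤ K' * h := by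
      intro w hw
      rw [hbr] at hw
      have hw2 : w ∈ ball y (r₁ / 2) := hballk (ball_subset_closedBall hw)
      calc ‖V s k - V s w‖ ≤ K * ‖k - w‖ := hlip s hsa w hw2 k hk2
        _ ≤ K' * h := by
          have hkw : ‖k - w‖ ≤ h := by
            rw [← dist_eq_norm, dist_comm]; exact (mem_ball.1 hw).le
          have hKK' : K ≤ K' := by rw [hK']; linarith
          exact mul_le_mul hKK' hkw (norm_nonneg _) hK'pos.le
    -- coordinates of `V(s, k)`
    have hcomp : ∀ i : Fin 3, |V s k i| ≤ τ + K' * h := by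
      intro i
      have h1 := abs_apply_sub_integral_bump_le (b k) hcontk hlipk i
      have h2 : |∫ z, ⟪V s z, φ k i z⟫| ≤ τ := by
        rw [← hUV k hkt i]
        exact hsm (k, i) (Finset.mem_product.2 ⟨(hmem_tF k).2 hkt, Finset.mem_univ _⟩)
      have h3 : |V s k i| ≤ |V s k i - ∫ z, ⟪V s z, φ k i z⟫| + |∫ z, ⟪V s z, φ k i z⟫| := by
        have := abs_add_le (V s k i - ∫ z, ⟪V s z, φ k i z⟫) (∫ z, ⟪V s z, φ k i z⟫)
        rwa [sub_add_cancel] at this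
      linarith
    have hnormk : ‖V s k‖ ≤ 2 * (τ + K' * h) :=
      norm_le_two_mul_of_forall_abs_apply_le (by positivity) hcomp
    have hkz : ‖V s z - V s k‖ ≤ K' * h := by
      calc ‖V s z - V s k‖ ≤ K * ‖z - k‖ := hlip s hsa k hk2 z hz2
        _ ≤ K' * h := by
          have hzk' : ‖z - k‖ ≤ h := by rw [← dist_eq_norm]; exact (mem_ball.1 hzk).le
          have hKK' : K ≤ K' := by rw [hK']; linarith
          exact mul_le_mul hKK' hzk' (norm_nonneg _) hK'pos.le
    calc ‖V s z‖ = ‖V s k + (V s z - V s k)‖ := by rw [add_sub_cancel]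
      _ ≤ ‖V s k‖ + ‖V s z - V s k‖ := norm_add_le _ _
      _ ≤ 2 * (τ + K' * h) + K' * h := add_le_add hnormk hkz
      _ ≤ θ₀ := by rw [hτ]; linarith
  -- integrate over `B(y, r)`
  have hslr : ∀ᵐ z ∂(volume.restrict (ball y r)), V s z = U s z :=
    ae_restrict_of_ae_restrict_of_subset (ball_subset_ball (by linarith)) hsl
  calc ∫⁻ z in ball y r, ‖U s z‖ₑ ^ 2 = ∫⁻ z in ball y r, ‖V s z‖ₑ ^ 2 :=
        lintegral_congr_ae (by filter_upwards [hslr] with z hz; rw [hz])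
    _ ≤ ∫⁻ _z in ball y r, ENNReal.ofReal (θ₀ ^ 2) := by
        refine setLIntegral_mono measurable_const fun z hz => ?_
        rw [← ofReal_norm, ← ENNReal.ofReal_pow (norm_nonneg _)]
        exact ENNReal.ofReal_le_ofReal (pow_le_pow_left₀ (norm_nonneg _) (hptw z hz) 2)
    _ = ENNReal.ofReal (θ₀ ^ 2) * volume (ball y r) := setLIntegral_const _ _
    _ ≤ ENNReal.ofReal θ := by
        rw [hθ₀sq, ← ENNReal.ofReal_toReal hvol, ← ENNReal.ofReal_mul (div_pos hθ hvpos).le]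
        refine ENNReal.ofReal_le_ofReal ?_
        have hle : (volume (ball y r)).toReal ≤ v := by rw [hv]; linarith
        calc θ / v * (volume (ball y r)).toReal ≤ θ / v * v :=
              mul_le_mul_of_nonneg_left hle (div_pos hθ hvpos).le
          _ = θ := div_mul_cancel₀ _ hvpos.ne'

end Summit.NavierStokesRegularity.NavierStokesRegularity.Theorems.TypeITraceScarL3

end
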